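import Mathlib.Tactic.Group
import Mathlib.GroupTheory.FreeGroup.Basic
import Mathlib.Data.Fintype.Card
import Mathlib.Data.Finset.BooleanAlgebra
import Literature.Topology.FourManifolds.BalancedPresentation
import Literature.Topology.FourManifolds.BalancedPresentationMoves
import Literature.Topology.FourManifolds.TriangularPresentationAndrewsCurtis
import HarnessLib
/-!
# `stub_roeSound : RoeSound` — recursive one-occurrence elimination certificates are Andrews–Curtis trivial
Theorems-lane text (decomp-sp4 writer g11, 2026-08-30; typed scaffold and plan by writer g10, critic decomp-sp4-crit-1
CLEARED FOR PROVING, CRITIC-LEDGER row 156).  Closes the registered NAME-shaped stub `stub_roeSound : RoeSound` of the line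
`grade_two_ac` (crux item stmt-SmoothPoincare4-32182, crux `RootDecompAE.DoublesShadowTwo`; tree
`Cruxes/DoublesShadowTwo/Lines/grade_two_ac.lean`), whose Roe block is byte-identical to that of the line `grade_four_ac`
(stmt-SmoothPoincare4-32183, crux `RootDecompAE.DoublesBeyondShadowTwo`; `Cruxes/DoublesBeyondShadowTwo/Lines/grade_four_ac.lean`).
Rung 0 of SmoothPoincare4: nothing here touches the summit; this is the pure free-group algebra half of the two shadow-grade lines.
THE STATEMENT `RoeSound` (no topology, no named fact): a balanced presentation `P = ⟨x₀…xₙ₋₁ ∣ r₀…rₙ₋₁⟩` that admits a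
RECURSIVE ONE-OCCURRENCE ELIMINATION CERTIFICATE (`Roe.HasCertificate P`: a list of steps `(r, x, W, ±)`; at each step the
relator `r`, after the substitutions `x' ↦ W'⁻¹` of the earlier steps, is conjugate to `(x·W)^{±1}` with `x` a fresh letter and
`W` a word in the letters not yet eliminated and different from `x`; at the end all letters are eliminated and all relators
used) is Andrews–Curtis equivalent — by the three moves of `Literature.Topology.FourManifolds.IsAndrewsCurtisEquivalent`,
WITHOUT stabilisation — to the trivial presentation `⟨x₀…xₙ₋₁ ∣ x₀…xₙ₋₁⟩`.
PROOF (tree lemmas only; no change of basis, no stabilisation).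
* FORWARD pass `freeze`: along the valid step list, the current relator `r` is conjugate to `(x·W)^{±1}`, so it is replaced by
  `x·W` (`IsAndrewsCurtisEquivalent.update_of_isConj`, `update_inv`); then `x ↦ W⁻¹` is substituted in every NOT-YET-USED
  relator (`subst_pass`): each substitution multiplies the relator by an element of the normal closure of `x·W = r`
  (`Roe.inv_mul_substHom_mem_normalClosure`), an Andrews–Curtis equivalence by
  `IsAndrewsCurtisEquivalent.update_mul_of_mem_normalClosure`.  Used relators are frozen: end state `Q' r_s = x_s · W_s`.
* BACKWARD pass `unwind` (last step first): `W_s` is a word in the letters eliminated AFTER `s`; once the later relators are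
  cleaned to exactly those letters, `W_s` is a consequence of them and `x_s·W_s ↦ x_s` (`update_mul_of_mem_normalClosure`).
* END: every relator is a generator and every generator occurs (`Roe.valid_exhaust`), so the presentation is the trivial one
  composed with a permutation: `IsAndrewsCurtisEquivalent.comp_perm`.
TWINS (critic ruling (x), CRITIC-LEDGER rows 153/154/156): `Roe.substHom`, `Roe.Step`, `Roe.Valid`, `Roe.HasCertificate`,
`RoeSound` in §1 are VERBATIM copies of `grade_two_ac.lean` l.456–494 / 523–525 = `grade_four_ac.lean` l.567–605 / 647–649
(sha256 of the extracted ranges 306ed563… / 73faf4dc…, identical in all three files); `example : RoeSound ↔ … := Iff.rfl` below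
re-certifies the statement text.  ANTI-SHADOWING (ruling (y)): the registered signature is the bare name `RoeSound`; besides the
twins this file declares no constant whose last name component occurs in it.
-/
open Function
open Literature.Topology.FourManifolds
set_option linter.dupNamespace false
noncomputable section
namespace Summit.SmoothPoincare4.SmoothPoincare4.Theorems.RootDecompAEDoublesShadowTwoStubRoeSound
/-! ## §1 Verbatim twins of the skeleton-local definitions (grade_two_ac.lean §4a / grade_four_ac.lean §4a) -/
namespace Roe

variable {n : ℕ}

/-- The substitution `x ↦ W⁻¹`, all other letters fixed. -/
def substHom (x : Fin n) (W : FreeGroup (Fin n)) : FreeGroup (Fin n) →* FreeGroup (Fin n) :=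
  FreeGroup.lift fun y => if y = x then W⁻¹ else FreeGroup.of y

/-- One elimination step: relator index, eliminated letter, the complementary word, and a sign. -/
structure Step (n : ℕ) where
  /-- the relator used at this step -/
  rel : Fin n
  /-- the letter eliminated at this step -/
  letter : Fin n
  /-- the word `W` with `relator ~ (letter · W)^{±1}` -/
  word : FreeGroup (Fin n)
  /-- `true`: the relator is conjugate to `letter · W`; `false`: to its inverse -/
  sgn : Bool

/-- VALIDITY of a step list from a state (accumulated substitution `Φ`, eliminated letters `E`, used relators `U`):
the next relator, AFTER the substitutions so far, is conjugate to `(x · W)^{±1}` with `x` fresh and `W` a word in the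
letters that are neither eliminated nor `x`; then `x ↦ W⁻¹` is composed into `Φ`.  At the end every letter is eliminated
and every relator used. -/
def Valid (P : BalancedPresentation n) :
    List (Step n) → (FreeGroup (Fin n) →* FreeGroup (Fin n)) → Finset (Fin n) → Finset (Fin n) → Prop
  | [], _, E, U => E = Finset.univ ∧ U = Finset.univ
  | s :: rest, Φ, E, U =>
      s.letter ∉ E ∧ s.rel ∉ U ∧
      s.word ∈ Subgroup.closure (FreeGroup.of '' {y : Fin n | y ∉ E ∧ y ≠ s.letter}) ∧
      IsConj (Φ (P s.rel))
        (if s.sgn then FreeGroup.of s.letter * s.word else (FreeGroup.of s.letter * s.word)⁻¹) ∧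
      Valid P rest ((substHom s.letter s.word).comp Φ) (insert s.letter E) (insert s.rel U)

/-- `P` admits a recursive one-occurrence elimination certificate.  (The grade-one ERASURE certificates of gen 12 —
`IsConj (erase_{rk < rk i} (P (σ i))) (xᵢ^{±1})` — are the special case `W = 1` at every step.) -/
def HasCertificate (P : BalancedPresentation n) : Prop :=
  ∃ steps : List (Step n), Valid P steps (MonoidHom.id _) ∅ ∅

end Roe
/-- STATEMENT OF STUB 3 (pure algebra): an elimination certificate implies Andrews–Curtis triviality (no stabilisation). -/
def RoeSound : Prop :=
  ∀ (n : ℕ) (P : BalancedPresentation n), Roe.HasCertificate P →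
    IsAndrewsCurtisEquivalent P (BalancedPresentation.trivial n)
/-- The registered statement text, re-certified against its verbatim unfolding (critic ruling (x), farm variant). -/
example : RoeSound ↔ (∀ (n : ℕ) (P : BalancedPresentation n), Roe.HasCertificate P →
    IsAndrewsCurtisEquivalent P (BalancedPresentation.trivial n)) := Iff.rfl
/-! ## §2 Unfolding the certificate predicate -/
variable {n : ℕ}
/-- Unfolding `Roe.Valid` on the empty list (definitional). -/
theorem Roe.valid_nil (P : BalancedPresentation n) (Φ : FreeGroup (Fin n) →* FreeGroup (Fin n))
    (E U : Finset (Fin n)) : Roe.Valid P [] Φ E U ↔ (E = Finset.univ ∧ U = Finset.univ) := Iff.rfl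
/-- Unfolding `Roe.Valid` on a cons, the head step written in components (definitional). -/
theorem Roe.valid_cons_mk (P : BalancedPresentation n) (r x : Fin n) (W : FreeGroup (Fin n)) (sgn : Bool)
    (rest : List (Roe.Step n)) (Φ : FreeGroup (Fin n) →* FreeGroup (Fin n)) (E U : Finset (Fin n)) :
    Roe.Valid P (Roe.Step.mk r x W sgn :: rest) Φ E U ↔
      (x ∉ E ∧ r ∉ U ∧
      W ∈ Subgroup.closure (FreeGroup.of '' {y : Fin n | y ∉ E ∧ y ≠ x}) ∧
      IsConj (Φ (P r)) (if sgn then FreeGroup.of x * W else (FreeGroup.of x * W)⁻¹) ∧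
      Roe.Valid P rest ((Roe.substHom x W).comp Φ) (insert x E) (insert r U)) := Iff.rfl
/-- The substitution `x ↦ W⁻¹` on a generator. -/
theorem Roe.substHom_of (x y : Fin n) (W : FreeGroup (Fin n)) :
    Roe.substHom x W (FreeGroup.of y) = if y = x then W⁻¹ else FreeGroup.of y := by
  unfold Roe.substHom
  rw [FreeGroup.lift_apply_of]
/-! ## §3 Bookkeeping carried by a valid certificate -/
/-- Along a valid step list from the state `(Φ, E, U)`, every step's letter avoids `E` and every step's relator avoids `U`. -/
theorem Roe.valid_avoid (P : BalancedPresentation n) :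
    ∀ (steps : List (Roe.Step n)) (Φ : FreeGroup (Fin n) →* FreeGroup (Fin n)) (E U : Finset (Fin n)),
      Roe.Valid P steps Φ E U → ∀ s ∈ steps, s.letter ∉ E ∧ s.rel ∉ U := by
  intro steps
  induction steps with
  | nil =>
    intro Φ E U _ s hs
    simp at hs
  | cons t rest ih =>
    intro Φ E U hv s hs
    obtain ⟨r, x, W, sgn⟩ := t
    obtain ⟨hxE, hrU, -, -, hrest⟩ := (Roe.valid_cons_mk P r x W sgn rest Φ E U).1 hv
    rcases List.mem_cons.1 hs with rfl | hs'
    · exact ⟨hxE, hrU⟩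
    · obtain ⟨h₁, h₂⟩ := ih _ _ _ hrest s hs'
      exact ⟨fun h => h₁ (Finset.mem_insert_of_mem h), fun h => h₂ (Finset.mem_insert_of_mem h)⟩
/-- Along a valid step list from the state `(Φ, E, U)`, every letter lies in `E` or is eliminated by some step, and every
relator lies in `U` or is used by some step (at the end `E = U = Finset.univ`). -/
theorem Roe.valid_exhaust (P : BalancedPresentation n) :
    ∀ (steps : List (Roe.Step n)) (Φ : FreeGroup (Fin n) →* FreeGroup (Fin n)) (E U : Finset (Fin n)),
      Roe.Valid P steps Φ E U →
        (∀ y, y ∈ E ∨ ∃ s ∈ steps, s.letter = y) ∧ (∀ j, j ∈ U ∨ ∃ s ∈ steps, s.rel = j) := by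
  intro steps
  induction steps with
  | nil =>
    intro Φ E U hv
    obtain ⟨hE, hU⟩ := (Roe.valid_nil P Φ E U).1 hv
    refine ⟨fun y => Or.inl ?_, fun j => Or.inl ?_⟩
    · rw [hE]; exact Finset.mem_univ y
    · rw [hU]; exact Finset.mem_univ j
  | cons t rest ih =>
    intro Φ E U hv
    obtain ⟨r, x, W, sgn⟩ := t
    obtain ⟨-, -, -, -, hrest⟩ := (Roe.valid_cons_mk P r x W sgn rest Φ E U).1 hv
    obtain ⟨hE, hU⟩ := ih _ _ _ hrest
    refine ⟨fun y => ?_, fun j => ?_⟩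
    · rcases hE y with h | ⟨s, hs, hsy⟩
      · rcases Finset.mem_insert.1 h with h' | h'
        · exact Or.inr ⟨Roe.Step.mk r x W sgn, List.mem_cons.2 (Or.inl rfl), h'.symm⟩
        · exact Or.inl h'
      · exact Or.inr ⟨s, List.mem_cons.2 (Or.inr hs), hsy⟩
    · rcases hU j with h | ⟨s, hs, hsj⟩
      · rcases Finset.mem_insert.1 h with h' | h'
        · exact Or.inr ⟨Roe.Step.mk r x W sgn, List.mem_cons.2 (Or.inl rfl), h'.symm⟩
        · exact Or.inl h'
      · exact Or.inr ⟨s, List.mem_cons.2 (Or.inr hs), hsj⟩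
/-! ## §4 The substitution `x ↦ W⁻¹` as Andrews–Curtis moves -/
/-- KERNEL DIRECTION OF THE SUBSTITUTION `x ↦ W⁻¹`: for every word `w`, `w⁻¹ · substHom x W w` lies in the normal closure of
`x·W` (induction on `w`; on the generator `x` it is `x⁻¹ W⁻¹ = (W (x W) W⁻¹)⁻¹`). -/
theorem Roe.inv_mul_substHom_mem_normalClosure (x : Fin n) (W w : FreeGroup (Fin n)) :
    w⁻¹ * Roe.substHom x W w ∈ Subgroup.normalClosure ({FreeGroup.of x * W} : Set (FreeGroup (Fin n))) := by
  set N : Subgroup (FreeGroup (Fin n)) :=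
    Subgroup.normalClosure ({FreeGroup.of x * W} : Set (FreeGroup (Fin n))) with hN
  have hNn : N.Normal := Subgroup.normalClosure_normal
  have hmem : FreeGroup.of x * W ∈ N := Subgroup.subset_normalClosure (Set.mem_singleton _)
  have hof : ∀ y : Fin n, (FreeGroup.of y)⁻¹ * Roe.substHom x W (FreeGroup.of y) ∈ N := by
    intro y
    rw [Roe.substHom_of]
    by_cases hy : y = x
    · rw [if_pos hy, hy]
      have h₁ : W * (FreeGroup.of x * W) * W⁻¹ ∈ N := hNn.conj_mem _ hmem W
      have e : (FreeGroup.of x)⁻¹ * W⁻¹ = (W * (FreeGroup.of x * W) * W⁻¹)⁻¹ := by group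
      rw [e]
      exact N.inv_mem h₁
    · rw [if_neg hy, inv_mul_cancel]
      exact N.one_mem
  induction w with
  | C1 => simp [N.one_mem]
  | of y => exact hof y
  | inv_of y _ =>
    rw [inv_inv, map_inv]
    have h₁ : (Roe.substHom x W (FreeGroup.of y))⁻¹ * FreeGroup.of y ∈ N := by
      have := N.inv_mem (hof y)
      simpa [mul_inv_rev] using this
    have h₂ := hNn.conj_mem _ h₁ (FreeGroup.of y)
    simpa [mul_assoc] using h₂
  | mul u v hu hv =>
    have e : (u * v)⁻¹ * Roe.substHom x W (u * v) =
        v⁻¹ * (u⁻¹ * Roe.substHom x W u) * v⁻¹⁻¹ * (v⁻¹ * Roe.substHom x W v) := by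
      rw [map_mul]; group
    rw [e]
    exact N.mul_mem (hNn.conj_mem _ hu v⁻¹) hv
/-- ONE SUBSTITUTION PASS: if the relator `r` IS `x·W`, substituting `x ↦ W⁻¹` in any finite set `T ∌ r` of other relators
is an Andrews–Curtis equivalence (each substitution multiplies a relator by a consequence of `r`). -/
theorem subst_pass (Q : BalancedPresentation n) (r x : Fin n) (W : FreeGroup (Fin n))
    (hr : Q r = FreeGroup.of x * W) (T : Finset (Fin n)) (hT : r ∉ T) :
    IsAndrewsCurtisEquivalent Q (fun j => if j ∈ T then Roe.substHom x W (Q j) else Q j) := by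
  induction T using Finset.induction_on with
  | empty =>
    have e : (fun j => if j ∈ (∅ : Finset (Fin n)) then Roe.substHom x W (Q j) else Q j) = Q := by
      funext j
      simp
    rw [e]
    exact IsAndrewsCurtisEquivalent.refl Q
  | insert a T ha ih =>
    have hra : r ≠ a := fun h => hT (h ▸ Finset.mem_insert_self a T)
    have hrT : r ∉ T := fun h => hT (Finset.mem_insert_of_mem h)
    obtain ⟨QT, hQT⟩ : ∃ QT : BalancedPresentation n,
        QT = fun j => if j ∈ T then Roe.substHom x W (Q j) else Q j := ⟨_, rfl⟩
    have h₁ : IsAndrewsCurtisEquivalent Q QT := by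
      rw [hQT]
      exact ih hrT
    have hQTr : QT r = FreeGroup.of x * W := by
      simp only [hQT, hrT, if_false, hr]
    have hQTa : QT a = Q a := by
      simp only [hQT, ha, if_false]
    have har : a ∉ ({r} : Set (Fin n)) := fun h => hra (Set.mem_singleton_iff.1 h).symm
    have hg : (Q a)⁻¹ * Roe.substHom x W (Q a) ∈
        Subgroup.normalClosure (QT '' ({r} : Set (Fin n))) := by
      rw [Set.image_singleton, hQTr]
      exact Roe.inv_mul_substHom_mem_normalClosure x W (Q a)
    have h₂ := IsAndrewsCurtisEquivalent.update_mul_of_mem_normalClosure QT har hg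
    have e : update QT a (QT a * ((Q a)⁻¹ * Roe.substHom x W (Q a))) =
        (fun j => if j ∈ insert a T then Roe.substHom x W (Q j) else Q j) := by
      funext j
      by_cases hja : j = a
      · rw [hja, update_self, hQTa, mul_inv_cancel_left]
        simp only [Finset.mem_insert_self, if_true]
      · rw [update_of_ne hja]
        have hj : (j ∈ insert a T) = (j ∈ T) := by
          rw [Finset.mem_insert]
          exact propext ⟨fun h => h.resolve_left hja, Or.inr⟩
        simp only [hQT, hj]
    rw [e] at h₂
    exact h₁.trans h₂
/-! ## §5 The forward pass -/
/-- FORWARD PASS (induction on the certificate, generalising the state `(Φ, E, U)` and the current presentation `Q`):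
if the used relators are arbitrary and the unused ones are `Φ ∘ P`, then `P` is Andrews–Curtis equivalent to a presentation
that agrees with `Q` on `U` and in which every step `s` of the list is frozen as `x_s · W_s`. -/
theorem freeze (P : BalancedPresentation n) :
    ∀ (steps : List (Roe.Step n)) (Φ : FreeGroup (Fin n) →* FreeGroup (Fin n)) (E U : Finset (Fin n))
      (Q : BalancedPresentation n),
      Roe.Valid P steps Φ E U → IsAndrewsCurtisEquivalent P Q → (∀ j, j ∉ U → Q j = Φ (P j)) →
      ∃ Q' : BalancedPresentation n, IsAndrewsCurtisEquivalent P Q' ∧ (∀ j ∈ U, Q' j = Q j) ∧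
        ∀ s ∈ steps, Q' s.rel = FreeGroup.of s.letter * s.word := by
  intro steps
  induction steps with
  | nil =>
    intro Φ E U Q _ hPQ _
    exact ⟨Q, hPQ, fun j _ => rfl, fun s hs => by simp at hs⟩
  | cons t rest ih =>
    intro Φ E U Q hv hPQ hQ
    obtain ⟨r, x, W, sgn⟩ := t
    obtain ⟨-, hrU, -, hconj, hrest⟩ := (Roe.valid_cons_mk P r x W sgn rest Φ E U).1 hv
    have hQr : Q r = Φ (P r) := hQ r hrU
    rw [← hQr] at hconj
    obtain ⟨Q₁, hQ₁⟩ : ∃ Q₁ : BalancedPresentation n, Q₁ = update Q r (FreeGroup.of x * W) := ⟨_, rfl⟩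
    have h₁ : IsAndrewsCurtisEquivalent Q Q₁ := by
      rw [hQ₁]
      cases sgn with
      | false =>
        rw [if_neg Bool.false_ne_true] at hconj
        have h₀ := IsAndrewsCurtisEquivalent.update_of_isConj Q r hconj
        have h₀' := IsAndrewsCurtisEquivalent.update_inv (update Q r (FreeGroup.of x * W)⁻¹) r
        rw [update_self, update_idem, inv_inv] at h₀'
        exact h₀.trans h₀'
      | true =>
        rw [if_pos rfl] at hconj
        exact IsAndrewsCurtisEquivalent.update_of_isConj Q r hconj
    have hQ₁r : Q₁ r = FreeGroup.of x * W := by rw [hQ₁, update_self]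
    have hQ₁ne : ∀ j, j ≠ r → Q₁ j = Q j := fun j hj => by rw [hQ₁, update_of_ne hj]
    have hrT : r ∉ (insert r U)ᶜ := fun h => (Finset.mem_compl.1 h) (Finset.mem_insert_self r U)
    have h₂ := subst_pass Q₁ r x W hQ₁r (insert r U)ᶜ hrT
    obtain ⟨Q₂, hQ₂⟩ : ∃ Q₂ : BalancedPresentation n,
        Q₂ = fun j => if j ∈ (insert r U)ᶜ then Roe.substHom x W (Q₁ j) else Q₁ j := ⟨_, rfl⟩
    rw [← hQ₂] at h₂
    have hQ₂off : ∀ j, j ∈ insert r U → Q₂ j = Q₁ j := by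
      intro j hj
      have hjT : j ∉ (insert r U)ᶜ := fun h => (Finset.mem_compl.1 h) hj
      simp only [hQ₂, hjT, if_false]
    have hQ₂on : ∀ j, j ∉ insert r U → Q₂ j = ((Roe.substHom x W).comp Φ) (P j) := by
      intro j hj
      have hjT : j ∈ (insert r U)ᶜ := Finset.mem_compl.2 hj
      have hjr : j ≠ r := fun h => hj (h ▸ Finset.mem_insert_self r U)
      have hjU : j ∉ U := fun h => hj (Finset.mem_insert_of_mem h)
      simp only [hQ₂, hjT, if_true]
      rw [hQ₁ne j hjr, hQ j hjU, MonoidHom.comp_apply]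
    obtain ⟨Q', hPQ', hQ'U, hQ'rest⟩ :=
      ih _ _ _ Q₂ hrest ((hPQ.trans h₁).trans h₂) hQ₂on
    refine ⟨Q', hPQ', fun j hj => ?_, fun s hs => ?_⟩
    · have hjr : j ≠ r := fun h => hrU (h ▸ hj)
      rw [hQ'U j (Finset.mem_insert_of_mem hj), hQ₂off j (Finset.mem_insert_of_mem hj), hQ₁ne j hjr]
    · rcases List.mem_cons.1 hs with rfl | hs'
      · show Q' r = FreeGroup.of x * W
        rw [hQ'U r (Finset.mem_insert_self r U), hQ₂off r (Finset.mem_insert_self r U), hQ₁r]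
      · exact hQ'rest s hs'
/-! ## §6 The backward pass -/
/-- BACKWARD PASS (induction on the certificate, tail cleaned first): if every step `s` of a valid list is frozen as
`x_s · W_s` in `Q₀`, then `Q₀` is Andrews–Curtis equivalent to a presentation in which every step's relator IS its letter,
unchanged off the steps' relators (`W_s` is a word in the letters of the later steps, which are by then exactly the later
relators, so `x_s W_s ↦ x_s W_s W_s⁻¹`). -/
theorem unwind (P : BalancedPresentation n) :
    ∀ (steps : List (Roe.Step n)) (Φ : FreeGroup (Fin n) →* FreeGroup (Fin n)) (E U : Finset (Fin n)),
      Roe.Valid P steps Φ E U → ∀ Q₀ : BalancedPresentation n,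
      (∀ s ∈ steps, Q₀ s.rel = FreeGroup.of s.letter * s.word) →
      ∃ Q : BalancedPresentation n, IsAndrewsCurtisEquivalent Q₀ Q ∧
        (∀ s ∈ steps, Q s.rel = FreeGroup.of s.letter) ∧
        (∀ j, (∀ s ∈ steps, s.rel ≠ j) → Q j = Q₀ j) := by
  intro steps
  induction steps with
  | nil =>
    intro Φ E U _ Q₀ _
    exact ⟨Q₀, IsAndrewsCurtisEquivalent.refl Q₀, fun s hs => by simp at hs, fun j _ => rfl⟩
  | cons t rest ih =>
    intro Φ E U hv Q₀ hfrozen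
    obtain ⟨r, x, W, sgn⟩ := t
    obtain ⟨hxE, -, hW, -, hrest⟩ := (Roe.valid_cons_mk P r x W sgn rest Φ E U).1 hv
    obtain ⟨Q₁, h₁, hQ₁clean, hQ₁off⟩ :=
      ih _ _ _ hrest Q₀ (fun s hs => hfrozen s (List.mem_cons.2 (Or.inr hs)))
    have hr_tail : ∀ s ∈ rest, s.rel ≠ r := by
      intro s hs h
      have h' := (Roe.valid_avoid P rest _ _ _ hrest s hs).2
      rw [h] at h'
      exact h' (Finset.mem_insert_self r U)
    have hQ₁r : Q₁ r = FreeGroup.of x * W := by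
      rw [hQ₁off r hr_tail]
      exact hfrozen (Roe.Step.mk r x W sgn) (List.mem_cons.2 (Or.inl rfl))
    have hWN : W ∈ Subgroup.normalClosure (Q₁ '' {j : Fin n | ∃ s ∈ rest, s.rel = j}) := by
      refine (Subgroup.closure_le _).2 ?_ hW
      rintro _ ⟨y, hy, rfl⟩
      obtain ⟨hyE, hyx⟩ : y ∉ E ∧ y ≠ x := hy
      obtain ⟨hEx, -⟩ := Roe.valid_exhaust P rest _ _ _ hrest
      rcases hEx y with h | ⟨s, hs, hsy⟩
      · rcases Finset.mem_insert.1 h with h' | h'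
        · exact (hyx h').elim
        · exact (hyE h').elim
      · rw [← hsy, ← hQ₁clean s hs]
        exact Subgroup.subset_normalClosure ⟨s.rel, ⟨s, hs, rfl⟩, rfl⟩
    have hg : W⁻¹ ∈ Subgroup.normalClosure (Q₁ '' {j : Fin n | ∃ s ∈ rest, s.rel = j}) := inv_mem hWN
    have hrS : r ∉ {j : Fin n | ∃ s ∈ rest, s.rel = j} := by
      rintro ⟨s, hs, hsr⟩
      exact hr_tail s hs hsr
    have h₂ := IsAndrewsCurtisEquivalent.update_mul_of_mem_normalClosure Q₁ hrS hg
    rw [hQ₁r, mul_inv_cancel_right] at h₂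
    refine ⟨update Q₁ r (FreeGroup.of x), h₁.trans h₂, fun s hs => ?_, fun j hj => ?_⟩
    · rcases List.mem_cons.1 hs with rfl | hs'
      · show update Q₁ r (FreeGroup.of x) r = FreeGroup.of x
        rw [update_self]
      · rw [update_of_ne (hr_tail s hs')]
        exact hQ₁clean s hs'
    · have hjr : j ≠ r := fun h => hj (Roe.Step.mk r x W sgn) (List.mem_cons.2 (Or.inl rfl)) h.symm
      rw [update_of_ne hjr]
      exact hQ₁off j (fun s hs => hj s (List.mem_cons.2 (Or.inr hs)))
/-! ## §7 Permuted trivial presentations and the assembly -/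
/-- A presentation whose relators are generators, every generator occurring, is the trivial presentation composed with a
permutation of `Fin n`, hence Andrews–Curtis trivial (`IsAndrewsCurtisEquivalent.comp_perm`). -/
theorem isAndrewsCurtisEquivalent_trivial_of_forall_exists_eq_of (Q : BalancedPresentation n)
    (hQ : ∀ j, ∃ y, Q j = FreeGroup.of y) (hsurj : ∀ y, ∃ j, Q j = FreeGroup.of y) :
    IsAndrewsCurtisEquivalent Q (BalancedPresentation.trivial n) := by
  choose lam hlam using hQ
  have hsurj' : Function.Surjective lam := by
    intro y
    obtain ⟨j, hj⟩ := hsurj y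
    refine ⟨j, FreeGroup.of_injective ?_⟩
    rw [← hlam j, hj]
  have hbij : Function.Bijective lam := Finite.surjective_iff_bijective.1 hsurj'
  have e : Q = BalancedPresentation.trivial n ∘ ⇑(Equiv.ofBijective lam hbij) := by
    funext j
    rw [Function.comp_apply, Equiv.ofBijective_apply, hlam j]
    rfl
  rw [e]
  exact (IsAndrewsCurtisEquivalent.comp_perm (BalancedPresentation.trivial n) (Equiv.ofBijective lam hbij)).symm
/-- **The registered stub of the lines `grade_two_ac` / `grade_four_ac`** (registered signature: the bare name `RoeSound`):
a recursive one-occurrence elimination certificate implies Andrews–Curtis triviality, without stabilisation. -/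
theorem stub_roeSound : RoeSound := by
  intro n P hP
  obtain ⟨steps, hv⟩ := hP
  obtain ⟨Q', hPQ', -, hfrozen⟩ := freeze P steps (MonoidHom.id _) ∅ ∅ P hv
    (IsAndrewsCurtisEquivalent.refl P) (fun j _ => (MonoidHom.id_apply _ (P j)).symm)
  obtain ⟨Q'', hQ'Q'', hclean, -⟩ := unwind P steps (MonoidHom.id _) ∅ ∅ hv Q' hfrozen
  obtain ⟨hE, hU⟩ := Roe.valid_exhaust P steps (MonoidHom.id _) ∅ ∅ hv
  have hQ : ∀ j, ∃ y, Q'' j = FreeGroup.of y := by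
    intro j
    rcases hU j with h | ⟨s, hs, hsj⟩
    · simp at h
    · exact ⟨s.letter, by rw [← hsj]; exact hclean s hs⟩
  have hsurj : ∀ y, ∃ j, Q'' j = FreeGroup.of y := by
    intro y
    rcases hE y with h | ⟨s, hs, hsy⟩
    · simp at h
    · exact ⟨s.rel, by rw [← hsy]; exact hclean s hs⟩
  exact (hPQ'.trans hQ'Q'').trans (isAndrewsCurtisEquivalent_trivial_of_forall_exists_eq_of Q'' hQ hsurj)
end Summit.SmoothPoincare4.SmoothPoincare4.Theorems.RootDecompAEDoublesShadowTwoStubRoeSound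
end
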